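import Summits.NavierStokesRegularity.NavierStokesRegularity.Theorems.PerpetualPumpCircuitPumpActiveCoreGate

/-!
# Joint bootstrap of the Toda clock box — the new bond and the spent bond, pointwise
# (crux `PerpetualPump.CircuitPump`, stmt-NavierStokesRegularity-1834; line `singular-clock-gspt`,
# sub-goal `toda_boot` of `stub_clockBox`, Toda `m = 2` instance)

Pure real inequalities used by one step of the continuity induction: the early bound of the new
bond (`t ≤ t₃`: Grönwall budget `lam (A+4) t₃ ≤ 0.85 Λ` against `A₂² ε^{3/20} ≤ 1/2`), the late
bound (`t₃ < t`: clock bookkeeping `log z ≤ (1/10) log ε + 28 log A₂ + 448 ≤ -3`), the carrier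
amplitude `W = A - ℓ₁ ± (903 + 50 log A)` recovered from the gate time `tg ∈ [τ⁻, τ⁺]`, the clock
budget `lam W (1 - e^{-νs})/ν ≤ lam W⁺ (Tmax - t₃)`, the spent bond `b₋₁ ≤ 1/2`, and the strict
corridor at time `0`. [folklore]
-/

set_option linter.dupNamespace false

noncomputable section

open Set

namespace Summit.NavierStokesRegularity.NavierStokesRegularity.Theorems.PerpetualPumpCircuitPump

/-- Early bound of the new bond (`t ≤ t₃`): the Grönwall bound of `toda_active_brackets` with
`lam (A+4) t₃ ≤ (17/20) Λ` gives `z ≤ (1/4) A₂² ε^{3/20} ≤ 1/8`. [folklore] -/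
theorem boot_z_early {lam ε A A₂ Λ t t₃ z : ℝ} (hlam0 : 0 < lam) (hlam2 : lam ≤ 3 / 2) (hε : 0 < ε)
    (hε1 : ε ≤ 1) (hΛ : Λ = -Real.log ε) (hA : 40000 ≤ A) (hAA₂ : A ≤ A₂)
    (HS3 : A₂ ^ 2 * ε ^ (3 / 20 : ℝ) ≤ 1 / 2) (h85 : lam * (A + 4) * t₃ ≤ 17 / 20 * Λ)
    (ht0 : 0 ≤ t) (ht3 : t ≤ t₃) (ht8 : t ≤ 1 / 8)
    (hz : z ≤ (ε ^ (3 / 2 : ℝ) + ε * lam * (A + 3) ^ 2 * t) * Real.exp (lam * (A + 4) * t)) :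
    z ≤ 1 / 8 := by
  have hexp : Real.exp (lam * (A + 4) * t) ≤ ε ^ (-(17 / 20 : ℝ)) := by
    rw [Real.rpow_def_of_pos hε]
    apply Real.exp_le_exp.mpr
    have : lam * (A + 4) * t ≤ lam * (A + 4) * t₃ := mul_le_mul_of_nonneg_left ht3 (by positivity)
    rw [hΛ] at h85
    linarith
  have h32 : ε ^ (3 / 2 : ℝ) ≤ ε := by
    have := Real.rpow_le_rpow_of_exponent_ge hε hε1 (by norm_num : (1 : ℝ) ≤ 3 / 2)
    rwa [Real.rpow_one] at this
  have hpre : ε ^ (3 / 2 : ℝ) + ε * lam * (A + 3) ^ 2 * t ≤ ε * (A₂ ^ 2 / 4) := by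
    have hlt : lam * t ≤ 3 / 16 := by nlinarith
    have h1 : ε * lam * (A + 3) ^ 2 * t ≤ ε * (3 / 16 * (A + 3) ^ 2) := by
      calc ε * lam * (A + 3) ^ 2 * t = ε * ((lam * t) * (A + 3) ^ 2) := by ring
        _ ≤ ε * (3 / 16 * (A + 3) ^ 2) := by gcongr
    have hA2 : A ^ 2 ≤ A₂ ^ 2 := by nlinarith
    have h2 : 1 + 3 / 16 * (A + 3) ^ 2 ≤ A₂ ^ 2 / 4 := by nlinarith
    nlinarith
  have hpos : 0 ≤ ε ^ (3 / 2 : ℝ) + ε * lam * (A + 3) ^ 2 * t := by positivity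
  have hεε : ε * ε ^ (-(17 / 20 : ℝ)) = ε ^ (3 / 20 : ℝ) := by
    calc ε * ε ^ (-(17 / 20 : ℝ)) = ε ^ (1 : ℝ) * ε ^ (-(17 / 20 : ℝ)) := by rw [Real.rpow_one]
      _ = ε ^ ((1 : ℝ) + -(17 / 20 : ℝ)) := (Real.rpow_add hε _ _).symm
      _ = ε ^ (3 / 20 : ℝ) := by norm_num
  calc z ≤ _ := hz
    _ ≤ ε * (A₂ ^ 2 / 4) * ε ^ (-(17 / 20 : ℝ)) :=
        mul_le_mul hpre hexp (Real.exp_pos _).le (by positivity)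
    _ = A₂ ^ 2 * ε ^ (3 / 20 : ℝ) / 4 := by linear_combination (A₂ ^ 2 / 4) * hεε
    _ ≤ 1 / 8 := by linarith

/-- Late bound of the new bond (`t₃ < t`): the clock bookkeeping
`log z ≤ log ε + 27 log A + 400 + (9/10) Λ + 48 + log A ≤ -3` under `Λ ≥ 10⁵ (log A₂ + 500)`.
[folklore] -/
theorem boot_z_late {ε A A₂ Λ G Lz Lz3 : ℝ} (hΛ : Λ = -Real.log ε)
    (HBIG : 100000 * (Real.log A₂ + 500) ≤ Λ) (hlogA : 10 ≤ Real.log A)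
    (hlogA2 : Real.log A ≤ Real.log A₂) (hG : G ≤ 9 / 10 * Λ)
    (h3 : Lz3 ≤ Real.log ε + 27 * Real.log A + 400) (hst : Lz - Lz3 ≤ G + 48 + Real.log A) :
    Lz ≤ -3 := by
  rw [hΛ] at HBIG hG
  linarith

/-- `log z ≤ -3` and `z > 0` give `z ≤ 1/8` (`e³ ≥ 8`). [folklore] -/
theorem boot_exp3 {z : ℝ} (hz : 0 < z) (h : Real.log z ≤ -3) : z ≤ 1 / 8 := by
  have h2 : (2 : ℝ) ≤ Real.exp 1 := by linarith [Real.add_one_le_exp (1 : ℝ)]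
  have h8 : (8 : ℝ) ≤ Real.exp 3 := by
    calc (8 : ℝ) = 2 ^ 3 := by norm_num
      _ ≤ Real.exp 1 ^ 3 := pow_le_pow_left₀ (by norm_num) h2 3
      _ = Real.exp 3 := by rw [← Real.exp_nat_mul]; norm_num
  have h1 : z ≤ Real.exp (-3) := by
    have := Real.exp_le_exp.mpr h
    rwa [Real.exp_log hz] at this
  rw [Real.exp_neg] at h1
  calc z ≤ (Real.exp 3)⁻¹ := h1
    _ ≤ 8⁻¹ := by gcongr
    _ = 1 / 8 := by norm_num

/-- **The carrier amplitude from the gate time.** `tg ∈ [τ⁻, τ⁺]` and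
`|W - A e^{-tg}| ≤ 900 + 50 log A` give `|W - (A - ℓ₁)| ≤ 903 + 50 log A`
(`A e^{-τ⁻} = A - ℓ₁ + 6/5`, `A e^{-τ⁺} = A - ℓ₁ - 11/5`); also `t₃ ≥ 0`. -/
theorem toda_boot_W :
    ∀ (ε A W tg : ℝ), 0 < ε → ε ≤ 1 → 40000 ≤ A → -Real.log ε ≤ A / 5 →
    -Real.log (1 - (-(Real.log ε) / 2 + Real.log (A / 8) - 6 / 5) / A) ≤ tg →
    tg ≤ -Real.log (1 - (-(Real.log ε) / 2 + Real.log (A / 8) + 11 / 5) / A) →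
    |W - A * Real.exp (-tg)| ≤ 900 + 50 * Real.log A →
    |W - (A - (-(Real.log ε) / 2 + Real.log (A / 8)))| ≤ 903 + 50 * Real.log A ∧
    0 ≤ -Real.log (1 - (-(Real.log ε) / 2 + Real.log (A / 8) + 11 / 5) / A) +
      (250 + 16 * Real.log A) / A := by
  intro ε A W tg hε hε1 hA hΛA htg1 htg2 hW
  have hA0 : 0 < A := by linarith
  have hlogs : Real.log (Real.sqrt ε) = Real.log ε / 2 := Real.log_sqrt hε.le
  have hlogv : -Real.log (Real.sqrt ε) ≤ A / 10 := by rw [hlogs]; linarith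
  have hℓ : -(Real.log ε) / 2 + Real.log (A / 8) = Real.log (A / 8) - Real.log (Real.sqrt ε) := by
    rw [hlogs]; ring
  obtain ⟨h34, hqm, hqA, hqA', -⟩ := period_levels hA hlogv hℓ
  have hqp : 0 < 1 - (-(Real.log ε) / 2 + Real.log (A / 8) + 11 / 5) / A := by linarith
  have hup : Real.exp (-tg) ≤ 1 - (-(Real.log ε) / 2 + Real.log (A / 8) - 6 / 5) / A := by
    have := Real.exp_le_exp.mpr (neg_le_neg htg1)
    rwa [neg_neg, Real.exp_log hqm] at this
  have hlo : 1 - (-(Real.log ε) / 2 + Real.log (A / 8) + 11 / 5) / A ≤ Real.exp (-tg) := by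
    have := Real.exp_le_exp.mpr (neg_le_neg htg2)
    rwa [neg_neg, Real.exp_log hqp] at this
  have hup' := mul_le_mul_of_nonneg_left hup hA0.le
  have hlo' := mul_le_mul_of_nonneg_left hlo hA0.le
  rw [hqA'] at hup'
  rw [hqA] at hlo'
  have hW' := abs_le.mp hW
  have hlogA : 0 < Real.log A := Real.log_pos (by linarith)
  have h8 : 0 ≤ Real.log (A / 8) := Real.log_nonneg (by linarith)
  have hlε : Real.log ε ≤ 0 := Real.log_nonpos hε.le hε1
  refine ⟨abs_le.mpr ⟨by linarith, by linarith⟩, add_nonneg ?_ (by positivity)⟩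
  rw [neg_nonneg]
  refine Real.log_nonpos hqp.le ?_
  have : 0 ≤ (-(Real.log ε) / 2 + Real.log (A / 8) + 11 / 5) / A := div_nonneg (by linarith) hA0.le
  linarith

/-- The clock budget after `t₃`: `lam W (1 - e^{-ν(t - t₃)})/ν ≤ lam W⁺ (Tmax - t₃)`. [folklore] -/
theorem boot_G {lam ν W Wp t T3 Tmax B : ℝ} (hlam : 0 ≤ lam) (hν : 0 < ν) (hW0 : 0 ≤ W)
    (hWWp : W ≤ Wp) (ht : T3 ≤ t) (hts : t ≤ Tmax) (h90 : lam * Wp * (Tmax - T3) ≤ B) :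
    lam * W * (1 - Real.exp (-ν * (t - T3))) / ν ≤ B := by
  have h1 : 1 - Real.exp (-ν * (t - T3)) ≤ ν * (t - T3) := by
    linarith [Real.add_one_le_exp (-ν * (t - T3))]
  have h2 : lam * W * (1 - Real.exp (-ν * (t - T3))) / ν ≤ lam * W * (t - T3) := by
    rw [div_le_iff₀ hν]
    have := mul_le_mul_of_nonneg_left h1 (mul_nonneg hlam hW0)
    linarith
  have h3 : lam * W * (t - T3) ≤ lam * Wp * (Tmax - T3) :=
    mul_le_mul (mul_le_mul_of_nonneg_left hWWp hlam) (by linarith) (by linarith)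
      (mul_nonneg hlam (hW0.trans hWWp))
  linarith

/-- The spent bond after one step: `b₋₁ ≤ (40q/A₁ + 4·169·ε q Tmax) e^{65 Tmax} ≤ 1/2`. [folklore] -/
theorem boot_bm1 {lam q ε A₁ Tmax t b0 bt : ℝ} (hq : q = lam ^ (1 / 5 : ℝ)) (hq0 : 0 ≤ q)
    (hε0 : 0 ≤ ε) (hA₁ : 0 < A₁) (ht0 : 0 ≤ t) (ht : t ≤ Tmax) (hb0 : b0 ≤ 40 * q / A₁)
    (hbt : bt ≤ (b0 + 4 * ε * 13 ^ 2 * lam ^ ((1 : ℝ) / 5) * t) * Real.exp ((4 * 13 + 13) * t))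
    (HS2 : (40 * q / A₁ + 4 * ε * 169 * q * Tmax) * Real.exp (65 * Tmax) ≤ 1 / 2) : bt ≤ 1 / 2 := by
  rw [← hq] at hbt
  have h1 : b0 + 4 * ε * 13 ^ 2 * q * t ≤ 40 * q / A₁ + 4 * ε * 169 * q * Tmax := by
    have := mul_le_mul_of_nonneg_left ht (by positivity : (0 : ℝ) ≤ 4 * ε * 169 * q)
    norm_num; linarith
  have h0 : 0 ≤ 40 * q / A₁ + 4 * ε * 169 * q * Tmax := by
    have : 0 ≤ Tmax := ht0.trans ht
    positivity
  have h2 : Real.exp ((4 * 13 + 13) * t) ≤ Real.exp (65 * Tmax) := Real.exp_le_exp.mpr (by linarith)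
  calc bt ≤ _ := hbt
    _ ≤ (40 * q / A₁ + 4 * ε * 169 * q * Tmax) * Real.exp (65 * Tmax) :=
        mul_le_mul h1 h2 (Real.exp_pos _).le h0
    _ ≤ 1 / 2 := HS2

/-- The corridor at time `0`, strictly: `b₁(0) ≤ ε^{3/2} < 1/4`, `b₋₁(0) ≤ 40q/A₁ ≤ 1/2 < 1`,
`|a₂(0)| ≤ ε² (2 lam)^{-2} < 1`. [folklore] -/
theorem boot_init {lam q ε A₁ Tmax b1 bm a2 : ℝ} (hlam : 1 < lam) (hε : 0 < ε)
    (hε5 : ε ≤ 1 / 100000) (hq0 : 0 ≤ q) (hA₁ : 0 < A₁) (hT : 0 ≤ Tmax) (hb1 : b1 ≤ ε ^ (3 / 2 : ℝ))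
    (hbm : bm ≤ 40 * q / A₁) (ha2 : a2 ≤ ε ^ 2 * (2 * lam) ^ (-((2 : ℤ) : ℝ)))
    (HS2 : (40 * q / A₁ + 4 * ε * 169 * q * Tmax) * Real.exp (65 * Tmax) ≤ 1 / 2) :
    b1 < 1 / 4 ∧ bm < 1 ∧ a2 < 1 := by
  have hε1 : ε ≤ 1 := by linarith
  have h32 : ε ^ (3 / 2 : ℝ) ≤ ε := by
    have := Real.rpow_le_rpow_of_exponent_ge hε hε1 (by norm_num : (1 : ℝ) ≤ 3 / 2)
    rwa [Real.rpow_one] at this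
  have h2 : (2 * lam) ^ (-((2 : ℤ) : ℝ)) ≤ 1 :=
    Real.rpow_le_one_of_one_le_of_nonpos (by linarith) (by norm_num)
  have h3 : ε ^ 2 * (2 * lam) ^ (-((2 : ℤ) : ℝ)) ≤ ε ^ 2 := mul_le_of_le_one_right (by positivity) h2
  have h4 : ε ^ 2 ≤ 1 / 100000 := by nlinarith
  have h5 : 40 * q / A₁ ≤ 1 / 2 := by
    have hX : 0 ≤ 4 * ε * 169 * q * Tmax := by positivity
    have hE : 1 ≤ Real.exp (65 * Tmax) := Real.one_le_exp (by positivity)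
    have h0 : 0 ≤ 40 * q / A₁ := by positivity
    nlinarith
  exact ⟨by linarith, by linarith, by linarith⟩

end Summit.NavierStokesRegularity.NavierStokesRegularity.Theorems.PerpetualPumpCircuitPump
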